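import Literature.NumberTheory.LFunctions.ClassGroupLFunctionRealZeros
import HarnessLib

/-!
# The pair Dirichlet series `(1/k!) Σ_n (Λ_χ(n) + Λ_{χ⁻¹}(n)) (log n)^k n^{−s}` and the
# Deuring–Heilbronn positivity

Topic `Literature/NumberTheory/LFunctions` (namespace `Literature.NumberTheory.LFunctions.NumberField`),
continuing `ClassGroupCharacterTwist.lean` (`−L'/L(s, χ) = L(Λ_χ, s)`, `Λ_χ = twistVonMangoldt K χ`) and
`ClassGroupLFunctionRealZeros.lean` (`classGroupCharIdealHom_mul`).
Everything here is PROVED; `pairLSeries` is a definition with body.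

For a class group character `ψ` of `K`, `k ∈ ℕ` and `Re s > 1` put
`P_k(ψ, s) = (1/k!) [ L((log)^k Λ_ψ, s) + L((log)^k Λ_{ψ⁻¹}, s) ]` (`pairLSeries`), so that
`P_k(ψ, s) = ((−1)^k/k!) [ (L(Λ_ψ,·))^{(k)}(s) + (L(Λ_{ψ⁻¹},·))^{(k)}(s) ]` (`pairLSeries_eq_iteratedDeriv`,
Mathlib's `LSeries_iteratedDeriv`).  The trigonometric device of the Deuring–Heilbronn phenomenon
[cite: ThornerZaman2017, §7.2 (the identity `0 ≤ (1 + ψ(𝔫))(1 + Re χ(𝔫)N𝔫^{−iγ})`)], summed over the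
pair `χ, χ̄` so that only pair sums occur:

* `dh_trig_nonneg` — `0 ≤ Re[(1 + a)(2 + z w + z̄ w)] (= (1 + a)(2 + 2 Re z Re w))` for `a ∈ {0, ±1}`,
  `|z| ≤ 1`, `|w| ≤ 1`;
* `re_pairLSeries_sum_nonneg` — for `χ₁² = 1`, any `χ`, `σ > 1`, `t ∈ ℝ`, `k ∈ ℕ`:
  `0 ≤ Re [ P_k(1, σ) + P_k(χ₁, σ) + P_k(χ, σ+it) + P_k(χ₁χ, σ+it) ]`.

## References

* J. Thorner, A. Zaman, Algebra Number Theory 11 (2017), §7.2. [ThornerZaman2017]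
* J. C. Lagarias, H. L. Montgomery, A. M. Odlyzko, Invent. Math. 54 (1979), §4. [LagariasMontgomeryOdlyzko1979]
-/

noncomputable section

open scoped NumberField LSeries.notation ComplexConjugate
open Complex Filter Topology Set NumberField LSeries

namespace Literature.NumberTheory.LFunctions.NumberField

variable {K : Type*} [Field K] [NumberField K]

/-! ### The Dirichlet series `L(Λ_χ, ·)` and its derivatives -/

/-- The abscissa of absolute convergence of `Λ_χ` is `≤ 1`. [folklore] -/
theorem abscissaOfAbsConv_twistVonMangoldt_le (χ : ClassGroup (𝓞 K) →* ℂˣ) :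
    abscissaOfAbsConv (twistVonMangoldt K (classGroupCharIdealHom χ)) ≤ 1 :=
  abscissaOfAbsConv_le_of_forall_lt_LSeriesSummable fun y hy ↦
    LSeriesSummable_twistVonMangoldt (norm_classGroupCharIdealHom_le χ) (by exact_mod_cast hy)

/-- `abscissa(Λ_χ) < Re s` for `Re s > 1`. [folklore] -/
theorem abscissaOfAbsConv_twistVonMangoldt_lt (χ : ClassGroup (𝓞 K) →* ℂˣ) {s : ℂ} (hs : 1 < s.re) :
    abscissaOfAbsConv (twistVonMangoldt K (classGroupCharIdealHom χ)) < s.re :=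
  lt_of_le_of_lt (abscissaOfAbsConv_twistVonMangoldt_le χ) (by exact_mod_cast hs)

/-- `L(Λ_χ, ·)` is `C^k` at every point with `Re s > 1`. [folklore] -/
theorem contDiffAt_LSeries_twistVonMangoldt (χ : ClassGroup (𝓞 K) →* ℂˣ) {s : ℂ} (hs : 1 < s.re)
    (k : ℕ) : ContDiffAt ℂ k (LSeries (twistVonMangoldt K (classGroupCharIdealHom χ))) s :=
  (LSeries_analyticOnNhd _ s (abscissaOfAbsConv_twistVonMangoldt_lt χ hs)).contDiffAt

/-- `L'/L(z, χ) = −L(Λ_χ, z)` for `Re z > 1`. [folklore] -/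
theorem logDeriv_classGroupLFunction_eq_neg_LSeries (χ : ClassGroup (𝓞 K) →* ℂˣ) {z : ℂ}
    (hz : 1 < z.re) :
    logDeriv (classGroupLFunction K χ) z = -LSeries (twistVonMangoldt K (classGroupCharIdealHom χ)) z := by
  rw [logDeriv_apply, ← neg_logDeriv_classGroupLFunction_eq K χ hz, neg_neg]

omit [NumberField K] in
/-- `logMul^[k] f = (log ·)^k · f`. [folklore] -/
theorem logMul_iterate_eq (f : ℕ → ℂ) (k : ℕ) : logMul^[k] f = fun n : ℕ ↦ Complex.log n ^ k * f n := by
  induction k with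
  | zero => funext n; simp
  | succ k ih =>
    funext n
    rw [Function.iterate_succ', Function.comp_apply, ih]
    simp only [logMul, pow_succ]
    ring

/-- `(log)^k Λ_χ` has an absolutely convergent `L`-series at `Re s > 1`. [folklore] -/
theorem LSeriesSummable_logPow_twistVonMangoldt (χ : ClassGroup (𝓞 K) →* ℂˣ) {s : ℂ} (hs : 1 < s.re)
    (k : ℕ) : LSeriesSummable (fun n : ℕ ↦ Complex.log n ^ k * twistVonMangoldt K (classGroupCharIdealHom χ) n) s := by
  rw [← logMul_iterate_eq]
  exact LSeriesSummable_of_abscissaOfAbsConv_lt_re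
    (absicssaOfAbsConv_logPowMul.symm ▸ abscissaOfAbsConv_twistVonMangoldt_lt χ hs)

/-- `((−1)^k/k!)(L(Λ_χ,·))^{(k)}(s) = (1/k!) L((log)^k Λ_χ, s)` (Mathlib's `LSeries_iteratedDeriv`).
[folklore] -/
theorem iteratedDeriv_LSeries_twistVonMangoldt_eq (χ : ClassGroup (𝓞 K) →* ℂˣ) {s : ℂ} (hs : 1 < s.re)
    (k : ℕ) :
    ((-1) ^ k / k.factorial : ℂ) *
        iteratedDeriv k (LSeries (twistVonMangoldt K (classGroupCharIdealHom χ))) s =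
      (1 / k.factorial : ℂ) *
        LSeries (fun n : ℕ ↦ Complex.log n ^ k * twistVonMangoldt K (classGroupCharIdealHom χ) n) s := by
  rw [LSeries_iteratedDeriv k (abscissaOfAbsConv_twistVonMangoldt_lt χ hs), logMul_iterate_eq]
  have hε : ((-1 : ℂ) ^ k) * (-1) ^ k = 1 := by rw [← mul_pow]; simp
  set L' : ℂ := LSeries (fun n : ℕ ↦ Complex.log n ^ k * twistVonMangoldt K (classGroupCharIdealHom χ) n) s
  rw [div_eq_mul_inv, one_div]
  linear_combination ((k.factorial : ℂ)⁻¹ * L') * hε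

/-! ### The pair series -/

variable (K) in
/-- **`P_k(ψ, s) = (1/k!) [ L((log)^k Λ_ψ, s) + L((log)^k Λ_{ψ⁻¹}, s) ]`**, the `k`-th "derivative sum"
of `−L'/L(ψ) − L'/L(ψ⁻¹)`. [cite: ThornerZaman2017, §7.2] -/
def pairLSeries (ψ : ClassGroup (𝓞 K) →* ℂˣ) (k : ℕ) (s : ℂ) : ℂ :=
  (1 / k.factorial : ℂ) *
    (LSeries (fun n : ℕ ↦ Complex.log n ^ k * twistVonMangoldt K (classGroupCharIdealHom ψ) n) s +
      LSeries (fun n : ℕ ↦ Complex.log n ^ k * twistVonMangoldt K (classGroupCharIdealHom ψ⁻¹) n) s)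

/-- `P_k(ψ, s) = ((−1)^k/k!) [ (L(Λ_ψ))^{(k)}(s) + (L(Λ_{ψ⁻¹}))^{(k)}(s) ]` for `Re s > 1`. [folklore] -/
theorem pairLSeries_eq_iteratedDeriv (ψ : ClassGroup (𝓞 K) →* ℂˣ) (k : ℕ) {s : ℂ} (hs : 1 < s.re) :
    pairLSeries K ψ k s = ((-1) ^ k / k.factorial : ℂ) *
      (iteratedDeriv k (LSeries (twistVonMangoldt K (classGroupCharIdealHom ψ))) s +
        iteratedDeriv k (LSeries (twistVonMangoldt K (classGroupCharIdealHom ψ⁻¹))) s) := by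
  rw [mul_add, iteratedDeriv_LSeries_twistVonMangoldt_eq ψ hs, iteratedDeriv_LSeries_twistVonMangoldt_eq ψ⁻¹ hs,
    pairLSeries, mul_add]

/-! ### Character values on ideals -/

/-- `χ⁻¹(I) = conj χ(I)` on ideals. [folklore] -/
theorem classGroupCharIdealHom_inv (χ : ClassGroup (𝓞 K) →* ℂˣ) (I : Ideal (𝓞 K)) :
    classGroupCharIdealHom χ⁻¹ I = conj (classGroupCharIdealHom χ I) := by
  by_cases hI : I = ⊥
  · rw [hI, classGroupCharIdealHom_bot, classGroupCharIdealHom_bot, map_zero]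
  · rw [classGroupCharIdealHom_apply_of_ne_bot _ hI, classGroupCharIdealHom_apply_of_ne_bot _ hI,
      MonoidHom.inv_apply, Units.val_inv_eq_inv_val, Complex.inv_eq_conj (norm_classGroupChar_apply χ _)]

/-- A real character takes the values `0, 1, −1` on ideals. [folklore] -/
theorem classGroupCharIdealHom_real_cases {χ₁ : ClassGroup (𝓞 K) →* ℂˣ} (h : χ₁ * χ₁ = 1)
    (I : Ideal (𝓞 K)) :
    classGroupCharIdealHom χ₁ I = 0 ∨ classGroupCharIdealHom χ₁ I = 1 ∨ classGroupCharIdealHom χ₁ I = -1 := by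
  by_cases hI : I = ⊥
  · left; rw [hI, classGroupCharIdealHom_bot]
  · right; rw [classGroupCharIdealHom_apply_of_ne_bot _ hI]
    exact classGroupChar_apply_eq_one_or_eq_neg_one h _

/-- The trivial character on ideals is `Λ`-a.e. `1`: `Λ_1 = Λ_K`. [folklore] -/
theorem twistVonMangoldt_one (n : ℕ) :
    twistVonMangoldt K (classGroupCharIdealHom (1 : ClassGroup (𝓞 K) →* ℂˣ)) n = (vonMangoldtNorm K n : ℂ) := by
  rw [classGroupCharIdealHom_one, twistVonMangoldt_trivialChar]

/-! ### The trigonometric inequality and the positivity of the pair combination -/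

omit [NumberField K] in
/-- **`0 ≤ Re[(1 + a)(2 + z w + z̄ w)] = (1 + a)(2 + 2 Re z · Re w)`** for `a ∈ {0, 1, −1}`, `|z| ≤ 1`,
`|w| ≤ 1`. [cite: ThornerZaman2017, §7.2] -/
theorem dh_trig_nonneg {a z w : ℂ} (ha : a = 0 ∨ a = 1 ∨ a = -1) (hz : ‖z‖ ≤ 1) (hw : ‖w‖ ≤ 1) :
    0 ≤ ((1 + a) * (2 + z * w + conj z * w)).re := by
  have hzr : |z.re| ≤ 1 := (abs_re_le_norm z).trans hz
  have hwr : |w.re| ≤ 1 := (abs_re_le_norm w).trans hw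
  have hprod : |z.re * w.re| ≤ 1 := by
    rw [abs_mul]
    calc |z.re| * |w.re| ≤ 1 * 1 := by gcongr
      _ = 1 := one_mul 1
  have hsum_re : (2 + z * w + conj z * w).re = 2 + 2 * (z.re * w.re) := by
    simp [mul_re]; ring
  have hnn : 0 ≤ (2 + z * w + conj z * w).re := by
    rw [hsum_re]; linarith [(abs_le.mp hprod).1]
  rcases ha with h | h | h <;> subst h
  · simpa using hnn
  · rw [mul_re]
    have : (1 + (1 : ℂ)).im = 0 := by simp
    rw [this, zero_mul, sub_zero]
    exact mul_nonneg (by norm_num) hnn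
  · simp

/-- The `n`-th term of the pair combination has non-negative real part:
`0 ≤ Re [ (2Λ_1(n) + 2Λ_{χ₁}(n)) n^{−σ} + (Λ_χ + Λ_{χ⁻¹} + Λ_{χ₁χ} + Λ_{(χ₁χ)⁻¹})(n) n^{−s} ]`, `s = σ + it`.
[cite: ThornerZaman2017, §7.2] -/
theorem re_pairTerm_nonneg {χ₁ : ClassGroup (𝓞 K) →* ℂˣ} (h₁ : χ₁ * χ₁ = 1)
    (χ : ClassGroup (𝓞 K) →* ℂˣ) {σ : ℝ} (t : ℝ) (n : ℕ) :
    0 ≤ ((2 * twistVonMangoldt K (classGroupCharIdealHom (1 : ClassGroup (𝓞 K) →* ℂˣ)) n +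
          2 * twistVonMangoldt K (classGroupCharIdealHom χ₁) n) * (n : ℂ) ^ (-(σ : ℂ)) +
        (twistVonMangoldt K (classGroupCharIdealHom χ) n + twistVonMangoldt K (classGroupCharIdealHom χ⁻¹) n +
          twistVonMangoldt K (classGroupCharIdealHom (χ₁ * χ)) n +
          twistVonMangoldt K (classGroupCharIdealHom (χ₁ * χ)⁻¹) n) * (n : ℂ) ^ (-((σ : ℂ) + t * I))).re := by
  rcases Nat.eq_zero_or_pos n with rfl | hn
  · simp [twistVonMangoldt_zero]
  have hn0 : (n : ℂ) ≠ 0 := by exact_mod_cast hn.ne'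
  -- `n^{−s} = n^{−σ} · w`, `w = n^{−it}`, `|w| = 1`
  set w : ℂ := (n : ℂ) ^ (-(t * I)) with hw
  have hw1 : ‖w‖ ≤ 1 := by
    rw [hw, Complex.norm_natCast_cpow_of_pos hn]; simp
  have hsplit : (n : ℂ) ^ (-((σ : ℂ) + t * I)) = (n : ℂ) ^ (-(σ : ℂ)) * w := by
    rw [hw, show -((σ : ℂ) + t * I) = -(σ : ℂ) + -(t * I) by ring, Complex.cpow_add _ _ hn0]
  have hreal : (n : ℂ) ^ (-(σ : ℂ)) = (((n : ℝ) ^ (-σ) : ℝ) : ℂ) := by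
    rw [Complex.ofReal_cpow (Nat.cast_nonneg n)]; push_cast; ring_nf
  have hpos : 0 ≤ (n : ℝ) ^ (-σ) := Real.rpow_nonneg (Nat.cast_nonneg n) _
  rw [hsplit, hreal]
  -- expand the coefficients over the ideals of norm `n`
  have key : ∀ I ∈ idealsOfNorm K n,
      0 ≤ (((idealVonMangoldt I * (n : ℝ) ^ (-σ) : ℝ) : ℂ) *
          ((1 + classGroupCharIdealHom χ₁ I) *
            (2 + classGroupCharIdealHom χ I * w + conj (classGroupCharIdealHom χ I) * w))).re := by
    intro I _
    rw [Complex.re_ofReal_mul]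
    exact mul_nonneg (mul_nonneg (idealVonMangoldt_nonneg I) hpos)
      (dh_trig_nonneg (classGroupCharIdealHom_real_cases h₁ I) (norm_classGroupCharIdealHom_le χ I) hw1)
  have ha : ∀ I, conj (classGroupCharIdealHom χ₁ I) = classGroupCharIdealHom χ₁ I :=
    fun I ↦ conj_classGroupCharIdealHom h₁ I
  simp only [twistVonMangoldt]
  simp only [add_mul, Finset.mul_sum, Finset.sum_mul, ← Finset.sum_add_distrib]
  rw [Complex.re_sum]
  refine Finset.sum_nonneg fun I hI ↦ le_of_le_of_eq (key I hI) ?_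
  congr 1
  rw [classGroupCharIdealHom_inv χ I, classGroupCharIdealHom_inv (χ₁ * χ) I, classGroupCharIdealHom_mul,
    map_mul, ha]
  have h1 : classGroupCharIdealHom (1 : ClassGroup (𝓞 K) →* ℂˣ) I = if I = ⊥ then 0 else 1 := by
    by_cases hI0 : I = ⊥
    · rw [if_pos hI0, hI0, classGroupCharIdealHom_bot]
    · rw [if_neg hI0, classGroupCharIdealHom_apply_of_ne_bot _ hI0, MonoidHom.one_apply, Units.val_one]
  by_cases hI0 : I = ⊥
  · exfalso
    subst hI0
    rw [mem_idealsOfNorm, Ideal.absNorm_bot] at hI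
    omega
  · rw [h1, if_neg hI0]
    push_cast
    ring

/-- **Deuring–Heilbronn positivity**: for a real character `χ₁` (`χ₁² = 1`), any character `χ`,
`σ > 1`, `t ∈ ℝ` and `k ∈ ℕ`,
`0 ≤ Re [ P_k(1, σ) + P_k(χ₁, σ) + P_k(χ, σ + it) + P_k(χ₁χ, σ + it) ]`.
[cite: ThornerZaman2017, §7.2] [cite: LagariasMontgomeryOdlyzko1979, §4] -/
theorem re_pairLSeries_sum_nonneg {χ₁ : ClassGroup (𝓞 K) →* ℂˣ} (h₁ : χ₁ * χ₁ = 1)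
    (χ : ClassGroup (𝓞 K) →* ℂˣ) {σ : ℝ} (hσ : 1 < σ) (t : ℝ) (k : ℕ) :
    0 ≤ (pairLSeries K 1 k σ + pairLSeries K χ₁ k σ + pairLSeries K χ k (σ + t * I) +
      pairLSeries K (χ₁ * χ) k (σ + t * I)).re := by
  have hσ' : 1 < (σ : ℂ).re := by simpa using hσ
  have hs' : 1 < ((σ : ℂ) + t * I).re := by simpa using hσ
  have hinv1 : (1 : ClassGroup (𝓞 K) →* ℂˣ)⁻¹ = 1 := by ext C; simp
  have hinvχ₁ : χ₁⁻¹ = χ₁ := by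
    refine MonoidHom.ext fun C ↦ ?_
    have hC : χ₁ C * χ₁ C = 1 := by rw [← MonoidHom.mul_apply, h₁, MonoidHom.one_apply]
    rw [MonoidHom.inv_apply, inv_eq_of_mul_eq_one_left hC]
  -- each `L`-series as a `tsum` of terms
  set T : (ClassGroup (𝓞 K) →* ℂˣ) → ℂ → ℕ → ℂ := fun ψ s n ↦
    term (fun n : ℕ ↦ Complex.log n ^ k * twistVonMangoldt K (classGroupCharIdealHom ψ) n) s n with hT
  have hS : ∀ (ψ : ClassGroup (𝓞 K) →* ℂˣ) (s : ℂ), 1 < s.re →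
      HasSum (T ψ s) (LSeries (fun n : ℕ ↦ Complex.log n ^ k * twistVonMangoldt K (classGroupCharIdealHom ψ) n) s) :=
    fun ψ s hs ↦ (LSeriesSummable_logPow_twistVonMangoldt ψ hs k).hasSum
  have hP : ∀ (ψ : ClassGroup (𝓞 K) →* ℂˣ) (s : ℂ), 1 < s.re →
      HasSum (fun n ↦ (1 / k.factorial : ℂ) * (T ψ s n + T ψ⁻¹ s n)) (pairLSeries K ψ k s) :=
    fun ψ s hs ↦ ((hS ψ s hs).add (hS ψ⁻¹ s hs)).mul_left _
  have hFsum := (((hP 1 σ hσ').add (hP χ₁ σ hσ')).add (hP χ (σ + t * I) hs')).add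
    (hP (χ₁ * χ) (σ + t * I) hs')
  have hk : (0 : ℝ) < 1 / k.factorial := by positivity
  rw [← hFsum.tsum_eq, Complex.re_tsum hFsum.summable]
  refine tsum_nonneg fun n ↦ ?_
  -- the `n`-th term
  rw [hinv1, hinvχ₁]
  rcases Nat.eq_zero_or_pos n with rfl | hn
  · simp [hT]
  have hterm : ∀ (ψ : ClassGroup (𝓞 K) →* ℂˣ) (s : ℂ), T ψ s n =
      Complex.log n ^ k * twistVonMangoldt K (classGroupCharIdealHom ψ) n * (n : ℂ) ^ (-s) := by
    intro ψ s
    rw [hT]; dsimp only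
    rw [term_of_ne_zero hn.ne', div_eq_mul_inv, ← Complex.cpow_neg]
  simp only [hterm]
  have hlog : (Complex.log n ^ k : ℂ) = (((Real.log n) ^ k : ℝ) : ℂ) := by
    rw [← Complex.natCast_log]; push_cast; rfl
  have hlog0 : 0 ≤ (Real.log n) ^ k := pow_nonneg (Real.log_natCast_nonneg n) k
  have hmain := re_pairTerm_nonneg h₁ χ (σ := σ) t n
  -- factor `(1/k!)(log n)^k` out
  have heq : (1 / k.factorial : ℂ) *
        (Complex.log n ^ k * twistVonMangoldt K (classGroupCharIdealHom 1) n * (n : ℂ) ^ (-(σ : ℂ)) +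
          Complex.log n ^ k * twistVonMangoldt K (classGroupCharIdealHom 1) n * (n : ℂ) ^ (-(σ : ℂ))) +
      (1 / k.factorial : ℂ) *
        (Complex.log n ^ k * twistVonMangoldt K (classGroupCharIdealHom χ₁) n * (n : ℂ) ^ (-(σ : ℂ)) +
          Complex.log n ^ k * twistVonMangoldt K (classGroupCharIdealHom χ₁) n * (n : ℂ) ^ (-(σ : ℂ))) +
      (1 / k.factorial : ℂ) *
        (Complex.log n ^ k * twistVonMangoldt K (classGroupCharIdealHom χ) n * (n : ℂ) ^ (-((σ : ℂ) + t * I)) +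
          Complex.log n ^ k * twistVonMangoldt K (classGroupCharIdealHom χ⁻¹) n * (n : ℂ) ^ (-((σ : ℂ) + t * I))) +
      (1 / k.factorial : ℂ) *
        (Complex.log n ^ k * twistVonMangoldt K (classGroupCharIdealHom (χ₁ * χ)) n * (n : ℂ) ^ (-((σ : ℂ) + t * I)) +
          Complex.log n ^ k * twistVonMangoldt K (classGroupCharIdealHom (χ₁ * χ)⁻¹) n *
            (n : ℂ) ^ (-((σ : ℂ) + t * I))) =
      (((1 / k.factorial * (Real.log n) ^ k : ℝ)) : ℂ) *
        ((2 * twistVonMangoldt K (classGroupCharIdealHom (1 : ClassGroup (𝓞 K) →* ℂˣ)) n +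
            2 * twistVonMangoldt K (classGroupCharIdealHom χ₁) n) * (n : ℂ) ^ (-(σ : ℂ)) +
          (twistVonMangoldt K (classGroupCharIdealHom χ) n + twistVonMangoldt K (classGroupCharIdealHom χ⁻¹) n +
            twistVonMangoldt K (classGroupCharIdealHom (χ₁ * χ)) n +
            twistVonMangoldt K (classGroupCharIdealHom (χ₁ * χ)⁻¹) n) * (n : ℂ) ^ (-((σ : ℂ) + t * I))) := by
    rw [hlog]; push_cast; ring
  rw [heq, Complex.re_ofReal_mul]
  exact mul_nonneg (mul_nonneg hk.le hlog0) hmain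

end Literature.NumberTheory.LFunctions.NumberField

end
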